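import Summits.NavierStokesRegularity.NavierStokesRegularity.Theses.LandauTail
import Literature.Analysis.FluidPDE.SelfSimilar
import Literature.Analysis.FluidPDE.SuitableWeak
import Literature.Analysis.FluidPDE.WeakSolution
import Literature.Analysis.FluidPDE.VectorCalculus
import Literature.Analysis.FluidPDE.PartialRegularity
import Literature.Analysis.FluidPDE.LocalTypeI
import Literature.Analysis.FluidPDE.LandauSolutions
import HarnessLib.Audit

/-!
# Skeleton of the crux `LandauTail.LandauTailBlowup` — line `registered`, lead cycle c7

Crux item `stmt-NavierStokesRegularity-1944` (decl
`Summit.NavierStokesRegularity.NavierStokesRegularity.Theses.LandauTail.LandauTailBlowup`), route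
`route-NavierStokesRegularity-LandauTail`. Tree path `Cruxes/LandauTailBlowup/Lines/registered.lean`; this cycle's
lead `prover-line-stmt-NavierStokesRegularity-1944-c7-0`, 2026-08-17 (continues the birth skeleton of
`planner-skel-stmt-NavierStokesRegularity-1944-0`, sha d2129068…, and leads c0–c6).

THE CUT (unchanged, proved tight in `Theorems/LandauTailLandauTailBlowupTightCut.lean`, p147753:
`LandauTailBlowup ↔ LandauTailLocal ∧ LandauTailTransfer`):

* `stub_landauTailLocal : LandauTail.LandauTailLocal` — twin BY NAME of item `stmt-NavierStokesRegularity-1946`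
  (the singularity MODEL; open research problem).
* `stub_landauTailTransfer : LandauTail.LandauTailTransfer` — twin BY NAME of item `stmt-NavierStokesRegularity-1948`
  (localisation; stub-blocked in three independent audits c2/c3/c4).

`LandauTailBlowup_of` is the ONLY theorem concluding the crux (modus ponens across the definitional seam
`LandauTailTransfer ↔ (LandauTailLocal → LandauTailBlowup) := Iff.rfl`).

LANDED SUPPORT (theorems about every witness of the body of `stub_landauTailLocal`, hence of the crux through the tight
cut; all `--supports stmt-NavierStokesRegularity-1944`): c2–c4 tight cut / Leray variables / Landau normal form / Osgood
(p147753 p150335 p152785 p153691 p154046 p154950); c5 Type II in every scaled `L^q`, `q > 2`, no envelope, point force,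
engine (p157640 … p163730); c6 energy-level portrait — scaled `L²`-defect floor, enstrophy/dissipation Type II, core
sup-norm Type II, `C(r), E(r) → ∞`, ¬Type I, Reynolds-defect identity (p166210 … p169268). Their registered stubs were
archived when this skeleton was re-registered; the statements live in the landed files.

SUPPORT STUBS OF CYCLE c7 (section `c7`): the MOMENTUM-LEVEL portrait = STRATEGY-CENSUS §F3 ("momentum bookkeeping",
there heuristic and conditional on `C¹` convergence with pressure) made unconditional theorems. The engine is the EXACT
LOCAL MOMENTUM LAW: for every classical unit-viscosity flow `v` on `(−1,0) × ℝ³` and the solenoidal PLATEAU test `φ_ρ`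
(`= a` on `B_{ρ/2}`, supported in `B_ρ`), `M_v(t) = ∫⟪v(t), φ_ρ⟫` has `M_v' = −2πβ(A) + E_ρ(t)` where `E_ρ(t)` is an
integral over the SHELL `ρ/2 < |y| < ρ` only (the plateau kills every error inside `B_{ρ/2}`; momentum enters the books
only through Landau's point force).

* W — worker stubs (independent): `landauTail_exists_plateau_test` (plateau solenoidal test as a curl, with bounds),
  `landauTail_momentum_hasDerivAt` (`d/dt ∫⟪v,φ⟫ = ∫⟪v,(v·∇)φ⟫ + ⟪v,Δφ⟫`), `landauTail_shell_flux_estimate` (the shell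
  error bound), `landauTail_vorticity_moment_bound` (`|∫⟪v, curl Ψ⟫| ≤ 4∫|Ψ||∇v|`), `landauTail_rescaled_energy_le`,
  `landauTail_rescaled_dissipation_eq` (scaling bookkeeping), `landauTail_limsup_cknA_eq_top_of_suitable` (suitable
  witnesses: `limsup A = ∞`, Seregin's critical-Morrey bound + `C(r) → ∞` of c6).
* L — lead compositions: `landauTail_momentum_law` (W2 + W3 + Landau's flux identity), `landauTail_shell_energy_floor`,
  `landauTail_shell_enstrophy_floor` (SHELL THEOREM: `L²`-closeness to Landau on a shell forces energy
  `≥ c(s₂−s₁)²ρ⁻³` and enstrophy `≥ c(s₂−s₁)³ρ⁻⁵` inside), `landauTail_core_radius_energy`,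
  `landauTail_core_radius_dissipation` (CORE-RADIUS WINDOW for Tsai-class flows: no Landau shell of radius `ρλ` with
  `ρ³ ≲ λ(s₂−s₁)²/C`, resp. `ρ⁵ ≲ λ(s₂−s₁)³/D_λ`, `D_λ → 0` — physical core radius `≫ (T−t)^{3/5}`),
  `landauTail_cknA_tendsto_top_of_tame` (tame witnesses: `A(r) → ∞`), `landauTail_momentum_loss_tame` (the momentum law
  in the limit: the core loses momentum to the jet at exactly Landau's force rate).

Disproof used: none exists for this crux (`ledger crux ls stmt-NavierStokesRegularity-1944`: no `Disproof.lean`).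
-/

namespace Summit.NavierStokesRegularity.NavierStokesRegularity.Cruxes.LandauTailBlowup.Birth

set_option linter.dupNamespace false

/-- **stub 1 — `stub_landauTailLocal` (XL, OPEN; twin by name of route item `stmt-NavierStokesRegularity-1946`,
`LandauTail.LandauTailLocal`, crux rank 2: the local-energy-class Landau-tailed first singularity exists,
ν = 1, singular point (0,0), no datum / decay constraint at infinity).** -/
theorem stub_landauTailLocal :
    Summit.NavierStokesRegularity.NavierStokesRegularity.Theses.LandauTail.LandauTailLocal := by
  sorry

/-- **stub 2 — `stub_landauTailTransfer` (L, OPEN; twin by name of route item `stmt-NavierStokesRegularity-1948`,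
`LandauTail.LandauTailTransfer`, crux rank 4: localisation — a local-energy-class Landau-tailed singularity can be
reproduced inside a finite-energy Leray–Hopf classical solution from a rapidly decaying datum).** -/
theorem stub_landauTailTransfer :
    Summit.NavierStokesRegularity.NavierStokesRegularity.Theses.LandauTail.LandauTailTransfer := by
  sorry

/-- **Birth composition (the skeleton theorem).** The crux BY NAME from the two registered stubs, used by name:
`LandauTailTransfer` unfolds to `(body of LandauTailLocal) → (body of LandauTailBlowup)`, so the application
type-checks across the definitional seam (kernel-checked delta-unfolding of the three route defs). -/
theorem LandauTailBlowup_of :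
    Summit.NavierStokesRegularity.NavierStokesRegularity.Theses.LandauTail.LandauTailBlowup :=
  stub_landauTailTransfer stub_landauTailLocal

/-! ## Cycle c7 support stubs (theorems about every witness; `--supports stmt-NavierStokesRegularity-1944`) -/

section c7

/-! ### W — worker stubs (independent pieces of the momentum law) -/

/-- **W1 — the solenoidal PLATEAU test** [folklore]: for every `a ∈ ℝ³` there is `K ≥ 0` such that for every
`ρ > 0` there is a `C^∞` divergence-free field `φ` supported in `B_ρ`, EQUAL TO `a` on the closed ball `B̄_{ρ/2}`
(so `Dφ = 0`, `Δφ = 0` there), with `|φ| ≤ K`, `‖Dφ‖ ≤ K/ρ`, `|Δφ| ≤ K/ρ²`, which is the curl of a smooth vector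
potential `Ψ` supported in `B_ρ` with `|Ψ| ≤ Kρ` (witness: `Ψ(y) = ½ η(|y|²/ρ²) (a × y)`, `η` a plateau cut-off). -/
theorem landauTail_exists_plateau_test : ∀ a : EuclideanSpace ℝ (Fin 3), ∃ K : ℝ, 0 ≤ K ∧ ∀ ρ : ℝ, 0 < ρ → ∃ (φ Ψ : EuclideanSpace ℝ (Fin 3) → EuclideanSpace ℝ (Fin 3)), ContDiff ℝ (⊤ : ℕ∞) φ ∧ HasCompactSupport φ ∧ tsupport φ ⊆ Metric.ball (0 : EuclideanSpace ℝ (Fin 3)) ρ ∧ (∀ x, Literature.Analysis.FluidPDE.VectorCalculus.divergence φ x = 0) ∧ (∀ x ∈ Metric.closedBall (0 : EuclideanSpace ℝ (Fin 3)) (ρ / 2), φ x = a) ∧ (∀ x ∈ Metric.closedBall (0 : EuclideanSpace ℝ (Fin 3)) (ρ / 2), fderiv ℝ φ x = 0) ∧ (∀ x ∈ Metric.closedBall (0 : EuclideanSpace ℝ (Fin 3)) (ρ / 2), Laplacian.laplacian φ x = 0) ∧ (∀ x, ‖φ x‖ ≤ K) ∧ (∀ x, ‖fderiv ℝ φ x‖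 ≤ K / ρ) ∧ (∀ x, ‖Laplacian.laplacian φ x‖ ≤ K / ρ ^ 2) ∧ ContDiff ℝ (⊤ : ℕ∞) Ψ ∧ HasCompactSupport Ψ ∧ tsupport Ψ ⊆ Metric.ball (0 : EuclideanSpace ℝ (Fin 3)) ρ ∧ (∀ x, φ x = Literature.Analysis.FluidPDE.curl Ψ x) ∧ (∀ x, ‖Ψ x‖ ≤ K * ρ) := by
  sorry

/-- **W2 — local momentum balance of a classical flow** [folklore; Fefferman (1)–(2) tested against a time-independent
solenoidal field]: for a classical unit-viscosity solution `(v, q)` of the unforced system on `ℝ³ × (−1,0)` and a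
smooth compactly supported divergence-free `φ`, `t ↦ ∫⟪v(t), φ⟫` is differentiable on `(−1,0)` with derivative
`∫ (⟪v, (v·∇)φ⟫ + ⟪v, Δφ⟫)` (differentiate under the integral, insert the momentum equation, integrate by parts; the
pressure drops out because `div φ = 0`); the flux `t ↦ ∫ (⟪v, (v·∇)φ⟫ + ⟪v, Δφ⟫)` is continuous on `(−1,0)`
(a parametric integral of a jointly continuous integrand over the compact `tsupport φ`). -/
theorem landauTail_momentum_hasDerivAt : ∀ (v : ℝ → EuclideanSpace ℝ (Fin 3) → EuclideanSpace ℝ (Fin 3)) (q : ℝ → EuclideanSpace ℝ (Fin 3) → ℝ) (φ : EuclideanSpace ℝ (Fin 3) → EuclideanSpace ℝ (Fin 3)), Literature.Analysis.FluidPDE.IsClassicalNSSolutionOn (Set.Ioo (-1) 0) 1 0 v q → ContDiff ℝ (⊤ : ℕ∞) φ → HasCompactSupport φ → (∀ x, Literature.Analysis.FluidPDE.VectorCalculus.divergence φ x = 0) → (∀ t ∈ Set.Ioo (-1 : ℝ) 0, HasDerivAt (fun s : ℝ => ∫ x, inner ℝ (v s x) (φ x)) (∫ x, (inner ℝ (v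 t x) (Literature.Analysis.FluidPDE.convect (v t) φ x) + inner ℝ (v t x) (Laplacian.laplacian φ x))) t) ∧ ContinuousOn (fun t : ℝ => ∫ x, (inner ℝ (v t x) (Literature.Analysis.FluidPDE.convect (v t) φ x) + inner ℝ (v t x) (Laplacian.laplacian φ x))) (Set.Ioo (-1 : ℝ) 0) := by
  sorry

/-- **W3 — the SHELL flux estimate** [folklore]: for a `C¹` field `V`, a field `U` continuous off the origin with
envelope `|U(x)| ≤ L/|x|`, and a `C²` test `φ` supported in `B_ρ` whose derivative and Laplacian vanish on `B̄_{ρ/2}`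
with `‖Dφ‖ ≤ K/ρ`, `|Δφ| ≤ K/ρ²`: the momentum fluxes `F(W) = ∫ (⟪W,(W·∇)φ⟫ + ⟪W, Δφ⟫)` of `V` and `U` differ by at
most `(K/ρ²)(1 + 4L) ∫_S |V − U| + (K/ρ) ∫_S |V − U|²`, `S = B_ρ ∖ B̄_{ρ/2}` the shell (expand
`F(V) − F(U) = ∫⟪w,Δφ⟫ + ⟪w,(U·∇)φ⟫ + ⟪U,(w·∇)φ⟫ + ⟪w,(w·∇)φ⟫`, `w = V − U`, all supported in the shell, where
`|U| ≤ 2L/ρ`). -/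
theorem landauTail_shell_flux_estimate : ∀ (V U φ : EuclideanSpace ℝ (Fin 3) → EuclideanSpace ℝ (Fin 3)) (ρ K L : ℝ), 0 < ρ → 0 ≤ K → 0 ≤ L → ContDiff ℝ 1 V → ContinuousOn U {0}ᶜ → (∀ x : EuclideanSpace ℝ (Fin 3), x ≠ 0 → ‖U x‖ ≤ L / ‖x‖) → ContDiff ℝ 2 φ → tsupport φ ⊆ Metric.ball (0 : EuclideanSpace ℝ (Fin 3)) ρ → (∀ x ∈ Metric.closedBall (0 : EuclideanSpace ℝ (Fin 3)) (ρ / 2), fderiv ℝ φ x = 0) → (∀ x ∈ Metric.closedBall (0 : EuclideanSpace ℝ (Fin 3)) (ρ / 2), Laplacian.laplacian φ x = 0) → (∀ x, ‖fderiv ℝ φ x‖ ≤ K / ρ) → (∀ x, ‖Laplacian.laplacian φ x‖ ≤ K / ρ ^ 2) → |(∫ x, (inner ℝ (V x) (Literature.Analysis.FluidPDE.convect V φ x) + inner ℝ (V x) (Laplacian.laplacian φ x))) - (∫ x, (inner ℝ (U x) (Literature.Analysis.FluidPDE.convect U φ x) + inner ℝ (U x) (Laplacian.laplacian φ x)))|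 ≤ K / ρ ^ 2 * (1 + 4 * L) * (∫ x in Metric.ball (0 : EuclideanSpace ℝ (Fin 3)) ρ \ Metric.closedBall (0 : EuclideanSpace ℝ (Fin 3)) (ρ / 2), ‖V x - U x‖) + K / ρ * (∫ x in Metric.ball (0 : EuclideanSpace ℝ (Fin 3)) ρ \ Metric.closedBall (0 : EuclideanSpace ℝ (Fin 3)) (ρ / 2), ‖V x - U x‖ ^ 2) := by
  sorry

/-- **W4 — the vorticity-moment bound** [folklore]: for a `C²` compactly supported vector potential `Ψ` and a `C¹`
field `v`, `|∫⟪v, curl Ψ⟫| ≤ 4 ∫ |Ψ| ‖Dv‖` (integrate `div (Ψ × v) = ⟪v, curl Ψ⟫ − ⟪Ψ, curl v⟫` over `ℝ³` and use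
`|curl v| ≤ 4‖Dv‖`): the momentum of a flow against a solenoidal test is a moment of its VORTICITY. -/
theorem landauTail_vorticity_moment_bound : ∀ (Ψ v : EuclideanSpace ℝ (Fin 3) → EuclideanSpace ℝ (Fin 3)), ContDiff ℝ 2 Ψ → HasCompactSupport Ψ → ContDiff ℝ 1 v → |∫ x, inner ℝ (v x) (Literature.Analysis.FluidPDE.curl Ψ x)| ≤ 4 * ∫ x, ‖Ψ x‖ * ‖fderiv ℝ v x‖ := by
  sorry

/-- **W5 — rescaled energy bookkeeping** [folklore]: under the Tsai bound `sup_{−1<t<0} ∫_{B₁}|u(t)|² ≤ C`, the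
parabolic rescaling `u_λ(s,y) = λ u(λ²s, λy)` (`nsRescale λ u`), `0 < λ ≤ 1`, has `∫_{B_R}|u_λ(s)|² ≤ C/λ` for every
`s ∈ (−1,0)` and every radius `R` with `Rλ ≤ 1` (change of variables `x = λy`). -/
theorem landauTail_rescaled_energy_le : ∀ (u : ℝ → EuclideanSpace ℝ (Fin 3) → EuclideanSpace ℝ (Fin 3)) (C : NNReal), (∀ t ∈ Set.Ioo (-1 : ℝ) 0, ∫⁻ x in Metric.ball (0 : EuclideanSpace ℝ (Fin 3)) 1, ‖u t x‖ₑ ^ 2 ≤ C) → ∀ lam : ℝ, 0 < lam → lam ≤ 1 → ∀ R : ℝ, 0 < R → R * lam ≤ 1 → ∀ s ∈ Set.Ioo (-1 : ℝ) 0, ∫⁻ x in Metric.ball (0 : EuclideanSpace ℝ (Fin 3)) R, ‖Literature.Analysis.FluidPDE.nsRescale lam u s x‖ₑ ^ 2 ≤ ENNReal.ofReal lam⁻¹ * C := by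
  sorry

/-- **W6 — rescaled dissipation bookkeeping** [folklore]: for every field `u`, every `λ > 0`, radius `R` and window
`(s₁, s₂)`, `∫_{s₁}^{s₂}∫_{B_R} |∇u_λ|² = λ⁻¹ ∫_{λ²s₁}^{λ²s₂}∫_{B_{λR}} |∇u|²` (`∇u_λ(s,y) = λ² ∇u(λ²s, λy)`,
`dt = λ² ds`, `dx = λ³ dy`; a change of variables under the measurable equivalence `(s,y) ↦ (λ²s, λy)`, no
measurability of `u` needed). -/
theorem landauTail_rescaled_dissipation_eq : ∀ (u : ℝ → EuclideanSpace ℝ (Fin 3) → EuclideanSpace ℝ (Fin 3)) (lam : ℝ), 0 < lam → ∀ R s₁ s₂ : ℝ, ∫⁻ z in Set.Ioo s₁ s₂ ×ˢ Metric.ball (0 : EuclideanSpace ℝ (Fin 3)) R, ENNReal.ofReal (Literature.Analysis.FluidPDE.frobeniusNormSq (fderiv ℝ (Literature.Analysis.FluidPDE.nsRescale lam u z.1) z.2)) = ENNReal.ofReal lam⁻¹ * ∫⁻ z in Set.Ioo (lam ^ 2 * s₁) (lam ^ 2 * s₂) ×ˢ Metric.ball (0 : EuclideanSpace ℝ (Fin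 3)) (lam * R), ENNReal.ofReal (Literature.Analysis.FluidPDE.frobeniusNormSq (fderiv ℝ (u z.1) z.2)) := by
  sorry

/-- **W7 — SUITABLE witnesses are Type II in Seregin's scaled energy `A`** (Seregin 2006/2014 §6.1 "one bounded
scaled energy bounds all", in tree as `Seregin2020.scaledEnergies_bounded_of_limsup_cknA_lt_top`, composed with the c6
theorem `landauTail_cknC_tendsto_top`): every Landau-tailed local classical solution of the body of
`LandauTail.LandauTailLocal` (classical on `(−1,0) × ℝ³`, finite dissipation in `Q₁`, Landau tail at `(0,0)`) which
is moreover a suitable weak solution in `Q₁(0,0)` with `D(1) < ∞` has `limsup_{r→0⁺} A(r) = ∞` — with the c6 theorems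
`C(r), E(r) → ∞`, Type II in all three of Seregin's scaled energies. -/
theorem landauTail_limsup_cknA_eq_top_of_suitable : ∀ (u : ℝ → EuclideanSpace ℝ (Fin 3) → EuclideanSpace ℝ (Fin 3)) (p : ℝ → EuclideanSpace ℝ (Fin 3) → ℝ) (U : EuclideanSpace ℝ (Fin 3) → EuclideanSpace ℝ (Fin 3)) (P : EuclideanSpace ℝ (Fin 3) → ℝ), (ContDiffOn ℝ (⊤ : ℕ∞) U {0}ᶜ ∧ ContDiffOn ℝ (⊤ : ℕ∞) P {0}ᶜ ∧ (∀ x : EuclideanSpace ℝ (Fin 3), x ≠ 0 → Literature.Analysis.FluidPDE.convect U U x + gradient P x = (1 : ℝ) • Laplacian.laplacian U x) ∧ (∀ x : EuclideanSpace ℝ (Fin 3), x ≠ 0 → Literature.Analysis.FluidPDE.VectorCalculus.divergence U x = 0) ∧ (∀ c : ℝ, 0 < c → ∀ x : EuclideanSpace ℝ (Fin 3), U (c • x) = c⁻¹ • U x) ∧ (∃ x : EuclideanSpace ℝ (Fin 3), U x ≠ 0)) → Literature.Analysis.FluidPDE.IsClassicalNSSolutionOn (Set.Ioo (-1) 0)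 1 0 u p → (∫⁻ t in Set.Ioo (-1 : ℝ) 0, ∫⁻ x in Metric.ball (0 : EuclideanSpace ℝ (Fin 3)) 1, ENNReal.ofReal (Literature.Analysis.FluidPDE.frobeniusNormSq (fderiv ℝ (u t) x)) < ⊤) → (∀ y : EuclideanSpace ℝ (Fin 3), y ≠ 0 → Filter.Tendsto (fun t : ℝ => Real.sqrt (0 - t) • u t (Real.sqrt (0 - t) • y)) (nhdsWithin 0 (Set.Iio 0)) (nhds (U y))) → Literature.Analysis.FluidPDE.IsSuitableWeakSolutionOn (Literature.Analysis.FluidPDE.parabolicCylinderOpens 1 ((0 : ℝ), (0 : EuclideanSpace ℝ (Fin 3)))) 1 0 u p → Literature.Analysis.FluidPDE.cknD 1 ((0 : ℝ), (0 : EuclideanSpace ℝ (Fin 3))) p ≠ ⊤ → Filter.limsup (fun r : ℝ => Literature.Analysis.FluidPDE.cknA r ((0 : ℝ), (0 : EuclideanSpace ℝ (Fin 3))) u) (nhdsWithin 0 (Set.Ioi 0)) = ⊤ := by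
  sorry

/-! ### L — lead compositions (the momentum law and its consequences) -/

/-- **L1 — the EXACT LOCAL MOMENTUM LAW** (lead; W2 + W3 + Landau's flux identity `landauTail_flux_identity` /
`landauTail_landau_flux_eq` / `landauTail_landau_flux_integral` + Šverák's normal form): for a nonzero steady
`(−1)`-homogeneous profile `(U, P)` smooth off the origin there are a unit vector `a` (the Landau axis), `β > 0`
(`= 2π β(A)`, Landau's force) and `L ≥ 0` (the envelope constant of `U`) such that for EVERY classical unit-viscosity
flow `(v, q)` on `ℝ³ × (−1,0)` and every plateau test `φ` of radius `ρ` with value `a` on `B̄_{ρ/2}`,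
`M(t) = ∫⟪v(t), φ⟫` satisfies `M'(t) = −β + E(t)` on `(−1,0)` with
`|E(t)| ≤ (K/ρ²)(1 + 4L)‖v(t) − U‖_{L¹(shell)} + (K/ρ)‖v(t) − U‖²_{L²(shell)}`. -/
theorem landauTail_momentum_law : ∀ (U : EuclideanSpace ℝ (Fin 3) → EuclideanSpace ℝ (Fin 3)) (P : EuclideanSpace ℝ (Fin 3) → ℝ), (ContDiffOn ℝ (⊤ : ℕ∞) U {0}ᶜ ∧ ContDiffOn ℝ (⊤ : ℕ∞) P {0}ᶜ ∧ (∀ x : EuclideanSpace ℝ (Fin 3), x ≠ 0 → Literature.Analysis.FluidPDE.convect U U x + gradient P x = (1 : ℝ) • Laplacian.laplacian U x) ∧ (∀ x : EuclideanSpace ℝ (Fin 3), x ≠ 0 → Literature.Analysis.FluidPDE.VectorCalculus.divergence U x = 0) ∧ (∀ c : ℝ, 0 < c → ∀ x : EuclideanSpace ℝ (Fin 3), U (c • x) = c⁻¹ • U x) ∧ (∃ x : EuclideanSpace ℝ (Fin 3), U x ≠ 0)) → ∃ a : EuclideanSpace ℝ (Fin 3), ‖a‖ = 1 ∧ ∃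 β : ℝ, 0 < β ∧ ∃ L : ℝ, 0 ≤ L ∧ ∀ (v : ℝ → EuclideanSpace ℝ (Fin 3) → EuclideanSpace ℝ (Fin 3)) (q : ℝ → EuclideanSpace ℝ (Fin 3) → ℝ), Literature.Analysis.FluidPDE.IsClassicalNSSolutionOn (Set.Ioo (-1) 0) 1 0 v q → ∀ (ρ K : ℝ) (φ : EuclideanSpace ℝ (Fin 3) → EuclideanSpace ℝ (Fin 3)), 0 < ρ → 0 ≤ K → ContDiff ℝ (⊤ : ℕ∞) φ → tsupport φ ⊆ Metric.ball (0 : EuclideanSpace ℝ (Fin 3)) ρ → (∀ x, Literature.Analysis.FluidPDE.VectorCalculus.divergence φ x = 0) → (∀ x ∈ Metric.closedBall (0 : EuclideanSpace ℝ (Fin 3)) (ρ / 2), φ x = a) → (∀ x ∈ Metric.closedBall (0 : EuclideanSpace ℝ (Fin 3)) (ρ / 2), fderiv ℝ φ x = 0) → (∀ x ∈ Metric.closedBall (0 : EuclideanSpace ℝ (Fin 3)) (ρ / 2), Laplacian.laplacian φ x = 0) → (∀ x, ‖fderiv ℝ φ x‖ ≤ K / ρ) → (∀ x, ‖Laplacian.laplacian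 φ x‖ ≤ K / ρ ^ 2) → (∀ t ∈ Set.Ioo (-1 : ℝ) 0, HasDerivAt (fun s : ℝ => ∫ x, inner ℝ (v s x) (φ x)) (∫ x, (inner ℝ (v t x) (Literature.Analysis.FluidPDE.convect (v t) φ x) + inner ℝ (v t x) (Laplacian.laplacian φ x))) t) ∧ ContinuousOn (fun t : ℝ => ∫ x, (inner ℝ (v t x) (Literature.Analysis.FluidPDE.convect (v t) φ x) + inner ℝ (v t x) (Laplacian.laplacian φ x))) (Set.Ioo (-1 : ℝ) 0) ∧ ∀ t ∈ Set.Ioo (-1 : ℝ) 0, |(∫ x, (inner ℝ (v t x) (Literature.Analysis.FluidPDE.convect (v t) φ x) + inner ℝ (v t x) (Laplacian.laplacian φ x))) + β| ≤ K / ρ ^ 2 * (1 + 4 * L) * (∫ x in Metric.ball (0 : EuclideanSpace ℝ (Fin 3)) ρ \ Metric.closedBall (0 : EuclideanSpace ℝ (Fin 3)) (ρ / 2), ‖v t x - U x‖) + K / ρ * (∫ x in Metric.ball (0 : EuclideanSpace ℝ (Fin 3)) ρ \ Metric.closedBall (0 : EuclideanSpace ℝ (Fin 3)) (ρ / 2),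 ‖v t x - U x‖ ^ 2) := by
  sorry

/-- **L2 — SHELL THEOREM, energy form** (lead; L1 + W1): there are `c, ε > 0` depending only on the profile such that
every classical unit-viscosity flow `v` on `ℝ³ × (−1,0)` which is `L²`-CLOSE TO THE LANDAU FLOW ON A SHELL,
`∫_{s₁}^{s₂}∫_{ρ/2<|y|<ρ} |v − U|² ≤ ε ρ (s₂ − s₁)` (a fixed fraction of Landau's own `L²`-mass there), carries at some
time of the window kinetic energy `∫_{B_ρ}|v(t)|² ≥ c (s₂ − s₁)² ρ⁻³` inside the shell: the momentum `≈ β(s₂ − s₁)`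
fed to the jet must sit inside, and energy `≥ momentum²/volume`. -/
theorem landauTail_shell_energy_floor : ∀ (U : EuclideanSpace ℝ (Fin 3) → EuclideanSpace ℝ (Fin 3)) (P : EuclideanSpace ℝ (Fin 3) → ℝ), (ContDiffOn ℝ (⊤ : ℕ∞) U {0}ᶜ ∧ ContDiffOn ℝ (⊤ : ℕ∞) P {0}ᶜ ∧ (∀ x : EuclideanSpace ℝ (Fin 3), x ≠ 0 → Literature.Analysis.FluidPDE.convect U U x + gradient P x = (1 : ℝ) • Laplacian.laplacian U x) ∧ (∀ x : EuclideanSpace ℝ (Fin 3), x ≠ 0 → Literature.Analysis.FluidPDE.VectorCalculus.divergence U x = 0) ∧ (∀ c : ℝ, 0 < c → ∀ x : EuclideanSpace ℝ (Fin 3), U (c • x) = c⁻¹ • U x) ∧ (∃ x : EuclideanSpace ℝ (Fin 3), U x ≠ 0)) → ∃ c : ℝ, 0 < c ∧ ∃ ε : ℝ, 0 < ε ∧ ∀ (v : ℝ → EuclideanSpace ℝ (Fin 3) → EuclideanSpace ℝ (Fin 3)) (q : ℝ → EuclideanSpace ℝ (Fin 3) → ℝ), Literature.Analysis.FluidPDE.IsClassicalNSSolutionOn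 (Set.Ioo (-1) 0) 1 0 v q → ∀ ρ : ℝ, 0 < ρ → ρ ≤ 1 → ∀ s₁ s₂ : ℝ, -1 < s₁ → s₁ < s₂ → s₂ < 0 → (∫⁻ z in Set.Ioo s₁ s₂ ×ˢ (Metric.ball (0 : EuclideanSpace ℝ (Fin 3)) ρ \ Metric.closedBall (0 : EuclideanSpace ℝ (Fin 3)) (ρ / 2)), ‖v z.1 z.2 - U z.2‖ₑ ^ 2) ≤ ENNReal.ofReal (ε * ρ * (s₂ - s₁)) → ∃ t ∈ Set.Icc s₁ s₂, ENNReal.ofReal (c * (s₂ - s₁) ^ 2 / ρ ^ 3) ≤ ∫⁻ x in Metric.ball (0 : EuclideanSpace ℝ (Fin 3)) ρ, ‖v t x‖ₑ ^ 2 := by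
  sorry

/-- **L3 — SHELL THEOREM, enstrophy form** (lead; L1 + W1 + W4): under the same shell closeness the flow dissipates
`∫_{s₁}^{s₂}∫_{B_ρ} |∇v|² ≥ c (s₂ − s₁)³ ρ⁻⁵` inside the shell (the momentum against a solenoidal test is a vorticity
moment: `|M(t)| ≤ 4Kρ ∫_{B_ρ}|∇v(t)|`). -/
theorem landauTail_shell_enstrophy_floor : ∀ (U : EuclideanSpace ℝ (Fin 3) → EuclideanSpace ℝ (Fin 3)) (P : EuclideanSpace ℝ (Fin 3) → ℝ), (ContDiffOn ℝ (⊤ : ℕ∞) U {0}ᶜ ∧ ContDiffOn ℝ (⊤ : ℕ∞) P {0}ᶜ ∧ (∀ x : EuclideanSpace ℝ (Fin 3), x ≠ 0 → Literature.Analysis.FluidPDE.convect U U x + gradient P x = (1 : ℝ) • Laplacian.laplacian U x) ∧ (∀ x : EuclideanSpace ℝ (Fin 3), x ≠ 0 → Literature.Analysis.FluidPDE.VectorCalculus.divergence U x = 0) ∧ (∀ c : ℝ, 0 < c → ∀ x : EuclideanSpace ℝ (Fin 3), U (c • x) = c⁻¹ • U x) ∧ (∃ x : EuclideanSpace ℝ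 (Fin 3), U x ≠ 0)) → ∃ c : ℝ, 0 < c ∧ ∃ ε : ℝ, 0 < ε ∧ ∀ (v : ℝ → EuclideanSpace ℝ (Fin 3) → EuclideanSpace ℝ (Fin 3)) (q : ℝ → EuclideanSpace ℝ (Fin 3) → ℝ), Literature.Analysis.FluidPDE.IsClassicalNSSolutionOn (Set.Ioo (-1) 0) 1 0 v q → ∀ ρ : ℝ, 0 < ρ → ρ ≤ 1 → ∀ s₁ s₂ : ℝ, -1 < s₁ → s₁ < s₂ → s₂ < 0 → (∫⁻ z in Set.Ioo s₁ s₂ ×ˢ (Metric.ball (0 : EuclideanSpace ℝ (Fin 3)) ρ \ Metric.closedBall (0 : EuclideanSpace ℝ (Fin 3)) (ρ / 2)), ‖v z.1 z.2 - U z.2‖ₑ ^ 2) ≤ ENNReal.ofReal (ε * ρ * (s₂ - s₁)) → ENNReal.ofReal (c * (s₂ - s₁) ^ 3 / ρ ^ 5) ≤ ∫⁻ z in Set.Ioo s₁ s₂ ×ˢ Metric.ball (0 : EuclideanSpace ℝ (Fin 3)) ρ, ENNReal.ofReal (Literature.Analysis.FluidPDE.frobeniusNormSq (fderiv ℝ (v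 z.1) z.2)) := by
  sorry

/-- **L4 — CORE RADIUS, energy form** (lead; L2 + W5): for every profile there are `c, ε > 0` such that for every
classical flow on `ℝ³ × (−1,0)` with Tsai's energy bound `sup_t ∫_{B₁}|u|² ≤ C`, at every scale `0 < λ ≤ 1` the
rescaling `u_λ` is NOT `L²`-close to the Landau flow on any shell of radius `ρ` with `C ρ³ < c λ (s₂ − s₁)²`: in
physical variables the flow deviates from its would-be Landau tail, by a fixed fraction of Landau's `L²`-mass, on every
shell inside radius `∼ (λ⁴(s₂−s₁)²/C)^{1/3}`, i.e. the non-Landau core has radius `≳ (T−t)^{2/3}`. -/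
theorem landauTail_core_radius_energy : ∀ (U : EuclideanSpace ℝ (Fin 3) → EuclideanSpace ℝ (Fin 3)) (P : EuclideanSpace ℝ (Fin 3) → ℝ), (ContDiffOn ℝ (⊤ : ℕ∞) U {0}ᶜ ∧ ContDiffOn ℝ (⊤ : ℕ∞) P {0}ᶜ ∧ (∀ x : EuclideanSpace ℝ (Fin 3), x ≠ 0 → Literature.Analysis.FluidPDE.convect U U x + gradient P x = (1 : ℝ) • Laplacian.laplacian U x) ∧ (∀ x : EuclideanSpace ℝ (Fin 3), x ≠ 0 → Literature.Analysis.FluidPDE.VectorCalculus.divergence U x = 0) ∧ (∀ c : ℝ, 0 < c → ∀ x : EuclideanSpace ℝ (Fin 3), U (c • x) = c⁻¹ • U x) ∧ (∃ x : EuclideanSpace ℝ (Fin 3), U x ≠ 0)) → ∃ c : ℝ, 0 < c ∧ ∃ ε : ℝ, 0 < ε ∧ ∀ (u : ℝ → EuclideanSpace ℝ (Fin 3) → EuclideanSpace ℝ (Fin 3)) (p : ℝ → EuclideanSpace ℝ (Fin 3) → ℝ) (C : NNReal), Literature.Analysis.FluidPDE.IsClassicalNSSolutionOn (Set.Ioo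 (-1) 0) 1 0 u p → (∀ t ∈ Set.Ioo (-1 : ℝ) 0, ∫⁻ x in Metric.ball (0 : EuclideanSpace ℝ (Fin 3)) 1, ‖u t x‖ₑ ^ 2 ≤ C) → ∀ lam : ℝ, 0 < lam → lam ≤ 1 → ∀ ρ : ℝ, 0 < ρ → ρ ≤ 1 → ∀ s₁ s₂ : ℝ, -1 < s₁ → s₁ < s₂ → s₂ < 0 → (C : ℝ) * ρ ^ 3 < c * lam * (s₂ - s₁) ^ 2 → ENNReal.ofReal (ε * ρ * (s₂ - s₁)) < ∫⁻ z in Set.Ioo s₁ s₂ ×ˢ (Metric.ball (0 : EuclideanSpace ℝ (Fin 3)) ρ \ Metric.closedBall (0 : EuclideanSpace ℝ (Fin 3)) (ρ / 2)), ‖Literature.Analysis.FluidPDE.nsRescale lam u z.1 z.2 - U z.2‖ₑ ^ 2 := by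
  sorry

/-- **L5 — CORE RADIUS, dissipation form** (lead; L3 + W6): with `D_λ = ∫_{λ²s₁}^{λ²s₂}∫_{B_λ} |∇u|²` (a tail of the
finite dissipation integral, `D_λ → 0`), the rescaling `u_λ` of a classical flow is NOT `L²`-close to the Landau flow on
any shell of radius `ρ ≤ 1` with `ρ⁵ D_λ < c λ (s₂ − s₁)³`: the radius of the non-Landau core in the rescaled picture
is `≫ λ^{1/5}`, in physical variables `≫ (T−t)^{3/5}` — STRATEGY-CENSUS F3's `β < 3/5`, for every flow and every scale. -/
theorem landauTail_core_radius_dissipation : ∀ (U : EuclideanSpace ℝ (Fin 3) → EuclideanSpace ℝ (Fin 3)) (P : EuclideanSpace ℝ (Fin 3) → ℝ), (ContDiffOn ℝ (⊤ : ℕ∞) U {0}ᶜ ∧ ContDiffOn ℝ (⊤ : ℕ∞) P {0}ᶜ ∧ (∀ x : EuclideanSpace ℝ (Fin 3), x ≠ 0 → Literature.Analysis.FluidPDE.convect U U x + gradient P x = (1 : ℝ) • Laplacian.laplacian U x) ∧ (∀ x : EuclideanSpace ℝ (Fin 3), x ≠ 0 → Literature.Analysis.FluidPDE.VectorCalculus.divergence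 U x = 0) ∧ (∀ c : ℝ, 0 < c → ∀ x : EuclideanSpace ℝ (Fin 3), U (c • x) = c⁻¹ • U x) ∧ (∃ x : EuclideanSpace ℝ (Fin 3), U x ≠ 0)) → ∃ c : ℝ, 0 < c ∧ ∃ ε : ℝ, 0 < ε ∧ ∀ (u : ℝ → EuclideanSpace ℝ (Fin 3) → EuclideanSpace ℝ (Fin 3)) (p : ℝ → EuclideanSpace ℝ (Fin 3) → ℝ), Literature.Analysis.FluidPDE.IsClassicalNSSolutionOn (Set.Ioo (-1) 0) 1 0 u p → ∀ lam : ℝ, 0 < lam → lam ≤ 1 → ∀ ρ : ℝ, 0 < ρ → ρ ≤ 1 → ∀ s₁ s₂ : ℝ, -1 < s₁ → s₁ < s₂ → s₂ < 0 → ENNReal.ofReal (ρ ^ 5) * (∫⁻ z in Set.Ioo (lam ^ 2 * s₁) (lam ^ 2 * s₂) ×ˢ Metric.ball (0 : EuclideanSpace ℝ (Fin 3)) lam, ENNReal.ofReal (Literature.Analysis.FluidPDE.frobeniusNormSq (fderiv ℝ (u z.1) z.2))) < ENNReal.ofReal (c * lam * (s₂ - s₁) ^ 3) → ENNReal.ofReal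 (ε * ρ * (s₂ - s₁)) < ∫⁻ z in Set.Ioo s₁ s₂ ×ˢ (Metric.ball (0 : EuclideanSpace ℝ (Fin 3)) ρ \ Metric.closedBall (0 : EuclideanSpace ℝ (Fin 3)) (ρ / 2)), ‖Literature.Analysis.FluidPDE.nsRescale lam u z.1 z.2 - U z.2‖ₑ ^ 2 := by
  sorry

/-- **L6 — TAME flows are Type II in Seregin's scaled energy `A`** (lead; L2): if the rescalings of a classical flow
become `L²`-close to the Landau flow on EVERY shell (for one window `−1 < s₁ < s₂ < 0`) — "tame": the defect is
confined to the core, as in every matched-asymptotics construction and in particular under locally uniform convergence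
off the time axis — then `A(r) = sup_{−r²<t<0} r⁻¹ ∫_{B_r}|u(t)|² → ∞` as `r → 0⁺` (with the rate
`A(λ) ≥ c (s₂−s₁)² ρ⁻³` for every tame shell radius `ρ`). -/
theorem landauTail_cknA_tendsto_top_of_tame : ∀ (U : EuclideanSpace ℝ (Fin 3) → EuclideanSpace ℝ (Fin 3)) (P : EuclideanSpace ℝ (Fin 3) → ℝ), (ContDiffOn ℝ (⊤ : ℕ∞) U {0}ᶜ ∧ ContDiffOn ℝ (⊤ : ℕ∞) P {0}ᶜ ∧ (∀ x : EuclideanSpace ℝ (Fin 3), x ≠ 0 → Literature.Analysis.FluidPDE.convect U U x + gradient P x = (1 : ℝ) • Laplacian.laplacian U x) ∧ (∀ x : EuclideanSpace ℝ (Fin 3), x ≠ 0 → Literature.Analysis.FluidPDE.VectorCalculus.divergence U x = 0) ∧ (∀ c : ℝ, 0 < c → ∀ x : EuclideanSpace ℝ (Fin 3), U (c • x) = c⁻¹ • U x) ∧ (∃ x : EuclideanSpace ℝ (Fin 3), U x ≠ 0)) → ∀ (u : ℝ → EuclideanSpace ℝ (Fin 3) → EuclideanSpace ℝ (Fin 3))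 (p : ℝ → EuclideanSpace ℝ (Fin 3) → ℝ), Literature.Analysis.FluidPDE.IsClassicalNSSolutionOn (Set.Ioo (-1) 0) 1 0 u p → ∀ s₁ s₂ : ℝ, -1 < s₁ → s₁ < s₂ → s₂ < 0 → (∀ ρ : ℝ, 0 < ρ → ρ ≤ 1 → Filter.Tendsto (fun lam : ℝ => ∫⁻ z in Set.Ioo s₁ s₂ ×ˢ (Metric.ball (0 : EuclideanSpace ℝ (Fin 3)) ρ \ Metric.closedBall (0 : EuclideanSpace ℝ (Fin 3)) (ρ / 2)), ‖Literature.Analysis.FluidPDE.nsRescale lam u z.1 z.2 - U z.2‖ₑ ^ 2) (nhdsWithin 0 (Set.Ioi 0)) (nhds 0)) → Filter.Tendsto (fun r : ℝ => Literature.Analysis.FluidPDE.cknA r ((0 : ℝ), (0 : EuclideanSpace ℝ (Fin 3))) u) (nhdsWithin 0 (Set.Ioi 0)) (nhds ⊤) := by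
  sorry

/-- **L7 — the momentum law in the tame limit** (lead; L1): along the rescalings `u_λ`, `λ → 0⁺`, of a classical
flow tame on the shell of radius `ρ` over the window `(s₁, s₂)`, the local momentum `M_λ(t) = ∫⟪u_λ(t), φ_ρ⟫`
against the plateau test loses exactly Landau's force: `M_λ(t₁) − M_λ(t₂) → β (t₂ − t₁)` for all
`s₁ ≤ t₁ < t₂ ≤ s₂` — STRATEGY-CENSUS F4 ("the inner solution is secular: it feeds momentum to the jet at the constant
rate b"), as a theorem under pointwise-free, `L²`-shell hypotheses. -/
theorem landauTail_momentum_loss_tame : ∀ (U : EuclideanSpace ℝ (Fin 3) → EuclideanSpace ℝ (Fin 3)) (P : EuclideanSpace ℝ (Fin 3) → ℝ), (ContDiffOn ℝ (⊤ : ℕ∞) U {0}ᶜ ∧ ContDiffOn ℝ (⊤ : ℕ∞) P {0}ᶜ ∧ (∀ x : EuclideanSpace ℝ (Fin 3), x ≠ 0 → Literature.Analysis.FluidPDE.convect U U x + gradient P x = (1 : ℝ) • Laplacian.laplacian U x) ∧ (∀ x : EuclideanSpace ℝ (Fin 3), x ≠ 0 → Literature.Analysis.FluidPDE.VectorCalculus.divergence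 U x = 0) ∧ (∀ c : ℝ, 0 < c → ∀ x : EuclideanSpace ℝ (Fin 3), U (c • x) = c⁻¹ • U x) ∧ (∃ x : EuclideanSpace ℝ (Fin 3), U x ≠ 0)) → ∃ a : EuclideanSpace ℝ (Fin 3), ‖a‖ = 1 ∧ ∃ β : ℝ, 0 < β ∧ ∀ (u : ℝ → EuclideanSpace ℝ (Fin 3) → EuclideanSpace ℝ (Fin 3)) (p : ℝ → EuclideanSpace ℝ (Fin 3) → ℝ), Literature.Analysis.FluidPDE.IsClassicalNSSolutionOn (Set.Ioo (-1) 0) 1 0 u p → ∀ (ρ K : ℝ) (φ : EuclideanSpace ℝ (Fin 3) → EuclideanSpace ℝ (Fin 3)), 0 < ρ → ρ ≤ 1 → 0 ≤ K → ContDiff ℝ (⊤ : ℕ∞) φ → tsupport φ ⊆ Metric.ball (0 : EuclideanSpace ℝ (Fin 3)) ρ → (∀ x, Literature.Analysis.FluidPDE.VectorCalculus.divergence φ x = 0) → (∀ x ∈ Metric.closedBall (0 : EuclideanSpace ℝ (Fin 3)) (ρ / 2), φ x = a) → (∀ x ∈ Metric.closedBall (0 : EuclideanSpace ℝ (Fin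 3)) (ρ / 2), fderiv ℝ φ x = 0) → (∀ x ∈ Metric.closedBall (0 : EuclideanSpace ℝ (Fin 3)) (ρ / 2), Laplacian.laplacian φ x = 0) → (∀ x, ‖fderiv ℝ φ x‖ ≤ K / ρ) → (∀ x, ‖Laplacian.laplacian φ x‖ ≤ K / ρ ^ 2) → ∀ s₁ s₂ : ℝ, -1 < s₁ → s₁ < s₂ → s₂ < 0 → Filter.Tendsto (fun lam : ℝ => ∫⁻ z in Set.Ioo s₁ s₂ ×ˢ (Metric.ball (0 : EuclideanSpace ℝ (Fin 3)) ρ \ Metric.closedBall (0 : EuclideanSpace ℝ (Fin 3)) (ρ / 2)), ‖Literature.Analysis.FluidPDE.nsRescale lam u z.1 z.2 - U z.2‖ₑ ^ 2) (nhdsWithin 0 (Set.Ioi 0)) (nhds 0) → ∀ t₁ t₂ : ℝ, s₁ ≤ t₁ → t₁ < t₂ → t₂ ≤ s₂ → Filter.Tendsto (fun lam : ℝ => (∫ x, inner ℝ (Literature.Analysis.FluidPDE.nsRescale lam u t₁ x) (φ x)) - ∫ x, inner ℝ (Literature.Analysis.FluidPDE.nsRescale lam u t₂ x) (φ x)) (nhdsWithin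 0 (Set.Ioi 0)) (nhds (β * (t₂ - t₁))) := by
  sorry

end c7

end Summit.NavierStokesRegularity.NavierStokesRegularity.Cruxes.LandauTailBlowup.Birth
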